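import Mathlib
import Summits.ValiantsHypothesis.ValiantsHypothesis.Theorems.BarrierLeverPartitionMinorsHitByVPHiddenStatesSecondShellAnyHCells

/-!
# Route BarrierLever — item `PartitionMinorsHitByVP` (stmt-ValiantsHypothesis-19717), line `hidden-states`:
# ★ THE SECOND-SHELL COMPOSITION TEMPLATE — «two transports + a cross minor vanishing in key form ⇒ served»

Helper file (`--supports stmt-ValiantsHypothesis-19717`; cell valiant-natproofs, 𝒟-side door (c), registered line
`Cruxes/PartitionMinorsHitByVP/Lines/hidden_states.lean` v8; prover seat val-np-p6 gen 18).  Closes NO item; definition-free.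

Every second-shell cell of gen 17 (`…SecondShellCells`, `…Oriented`, `…Funnel`, `…Nested*`, `…EqualY`, `…TwoTops`) repeats the
same ≈ 100 lines of bookkeeping: the row family `u` ranges in `B_t(h) ∖ {A₁, A₂} ∪ {C₁, C₂}`, the two slots `i₁, i₂` of `C₁, C₂`
are located (`rows_cover`), the ball enumeration `b = u[i₁ ↦ A₁][i₂ ↦ A₂]` is formed, the two first-shell certificates come from
`swapTable'_det_ne_zero` for the two transports, and the exchange composition `exists_table_of_cross_zero` finishes once ONE cross
minor vanishes identically.  ★ `exists_table_secondShell_of_cross` packages all of it: the caller supplies the two transports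
`e₁, e₂` (any orientation) and the vanishing of `D_{B−A₁+C₂}` or of `D_{B−A₂+C₁}` in KEY FORM — for every row family `rows` with
`rows i₀ =` the new row whose other rows contain every set of size `≤ t` except the missing one, and columns of size `≤ t`, the
determinant of the two-parameter table vanishes for every parameter (exactly the shape of `nestedShared_cross_det_eq_zero` and of
the three-mover chain lemma's output).  First client: the parallel nested cell (`…SecondShellParallelNested`).

HONEST LABEL: conjecture-column toolkit (second shell, every `t, h`); 19717 stays OPEN; nothing on crux 14610 or VP ≠ VNP.
-/

set_option linter.dupNamespace false

namespace Summit.ValiantsHypothesis.ValiantsHypothesis.Theorems.BarrierLever.HiddenStates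

open Finset

noncomputable section

namespace SecondShell

open PathTable

/-- ★ **THE SECOND-SHELL COMPOSITION TEMPLATE.**  Transports `e₁` for the swap `A₁ → C₁` and `e₂` for `A₂ → C₂` (sizes
`k_l + j_l = t`, `k_l ≥ 1`), a row family ranging in the second-shell family with columns covering the ball, and ONE cross minor of
the two-parameter table `I + ε₀N₁ + ε₁N₂` (`N_l = swapTable' e_l − I`) vanishing in key form ⇒ the family is served. -/
theorem exists_table_secondShell_of_cross (h t : ℕ) (A₁ A₂ C₁ C₂ : Finset (Fin h))
    (hA₁ : A₁.card = t) (hA₂ : A₂.card = t) (hC₁ : C₁.card = t + 1) (hC₂ : C₂.card = t + 1)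
    (hA : A₁ ≠ A₂) (hC : C₁ ≠ C₂)
    {k₁ j₁ j₁' k₂ j₂ j₂' : ℕ} (hk₁ : 1 ≤ k₁) (hkj₁ : k₁ + j₁ = t) (hk₂ : 1 ≤ k₂) (hkj₂ : k₂ + j₂ = t)
    (e₁ : (Fin (k₁ + 1) ⊕ Fin k₁) ⊕ (Fin j₁ ⊕ Fin j₁') ≃ Fin h)
    (m1 : ∀ x, e₁ (Sum.inl (Sum.inl x)) ∈ C₁ \ A₁) (m2 : ∀ i, e₁ (Sum.inl (Sum.inr i)) ∈ A₁ \ C₁)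
    (m3 : ∀ z, e₁ (Sum.inr (Sum.inl z)) ∈ A₁ ∩ C₁) (m4 : ∀ x, e₁ (Sum.inr (Sum.inr x)) ∈ (A₁ ∪ C₁)ᶜ)
    (e₂ : (Fin (k₂ + 1) ⊕ Fin k₂) ⊕ (Fin j₂ ⊕ Fin j₂') ≃ Fin h)
    (n1 : ∀ x, e₂ (Sum.inl (Sum.inl x)) ∈ C₂ \ A₂) (n2 : ∀ i, e₂ (Sum.inl (Sum.inr i)) ∈ A₂ \ C₂)
    (n3 : ∀ z, e₂ (Sum.inr (Sum.inl z)) ∈ A₂ ∩ C₂) (n4 : ∀ x, e₂ (Sum.inr (Sum.inr x)) ∈ (A₂ ∪ C₂)ᶜ)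
    {r : ℕ} (u cols : Fin r → Finset (Fin h)) (hu : Function.Injective u)
    (hU : ∀ i, ((u i).card ≤ t ∧ u i ≠ A₁ ∧ u i ≠ A₂) ∨ u i = C₁ ∨ u i = C₂)
    (hcols : ∀ J : Finset (Fin h), J.card ≤ t → ∃ kk, cols kk = J)
    (hZ : (∀ (rows : Fin r → Finset (Fin h)) (i₀ : Fin r), rows i₀ = C₂ →
        (∀ S : Finset (Fin h), S.card ≤ t → S ≠ A₁ → ∃ i, i ≠ i₀ ∧ rows i = S) → (∀ kk, (cols kk).card ≤ t) →
        ∀ ε, (mat (tab2 (fun a q => swapTable' e₁ a q - if q = a then 1 else 0)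
          (fun a q => swapTable' e₂ a q - if q = a then 1 else 0) ε) rows cols).det = 0) ∨
      (∀ (rows : Fin r → Finset (Fin h)) (i₀ : Fin r), rows i₀ = C₁ →
        (∀ S : Finset (Fin h), S.card ≤ t → S ≠ A₂ → ∃ i, i ≠ i₀ ∧ rows i = S) → (∀ kk, (cols kk).card ≤ t) →
        ∀ ε, (mat (tab2 (fun a q => swapTable' e₁ a q - if q = a then 1 else 0)
          (fun a q => swapTable' e₂ a q - if q = a then 1 else 0) ε) rows cols).det = 0)) :
    ∃ tx : Option (Fin h) → Fin h → ℂ,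
      (Matrix.of fun i kk : Fin r => ∏ a ∈ u i, (tx none a + ∑ q ∈ cols kk, tx (some q) a)).det ≠ 0 := by
  classical
  set N₁ : Fin h → Fin h → ℂ := fun a q => swapTable' e₁ a q - if q = a then 1 else 0 with hN₁
  set N₂ : Fin h → Fin h → ℂ := fun a q => swapTable' e₂ a q - if q = a then 1 else 0 with hN₂
  have hT10 : tab2 N₁ N₂ ![1, 0] = swapTable' e₁ := by funext a q; simp [tab2, hN₁]
  have hT01 : tab2 N₁ N₂ ![0, 1] = swapTable' e₂ := by funext a q; simp [tab2, hN₂]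
  -- the ball and the second-shell family
  set Ball := Finset.univ.filter fun S : Finset (Fin h) => S.card ≤ t with hBall
  set 𝒰 := insert C₁ (insert C₂ ((Ball.erase A₁).erase A₂)) with h𝒰
  have hBA₁ : A₁ ∈ Ball := Finset.mem_filter.2 ⟨Finset.mem_univ _, by omega⟩
  have hBA₂ : A₂ ∈ Ball := Finset.mem_filter.2 ⟨Finset.mem_univ _, by omega⟩
  have hBC₁ : C₁ ∉ Ball := fun h' => by have := (Finset.mem_filter.1 h').2; omega
  have hBC₂ : C₂ ∉ Ball := fun h' => by have := (Finset.mem_filter.1 h').2; omega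
  have h𝒰card : 𝒰.card = Ball.card := card_secondShell_rows Ball hBA₁ hBA₂ hBC₁ hBC₂ hA hC
  have hUmem : ∀ i, u i ∈ 𝒰 := by
    intro i
    rcases hU i with ⟨hc, hne₁, hne₂⟩ | h' | h'
    · refine Finset.mem_insert_of_mem (Finset.mem_insert_of_mem ?_)
      exact Finset.mem_erase.2 ⟨hne₂, Finset.mem_erase.2 ⟨hne₁, Finset.mem_filter.2 ⟨Finset.mem_univ _, hc⟩⟩⟩
    · rw [h']; exact Finset.mem_insert_self _ _
    · rw [h']; exact Finset.mem_insert_of_mem (Finset.mem_insert_self _ _)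
  obtain ⟨hhit, hcolcard⟩ := rows_cover t 𝒰 h𝒰card u cols hu hUmem hcols
  obtain ⟨i₁, hi₁⟩ := hhit C₁ (Finset.mem_insert_self _ _)
  obtain ⟨i₂, hi₂⟩ := hhit C₂ (Finset.mem_insert_of_mem (Finset.mem_insert_self _ _))
  have hne : i₁ ≠ i₂ := fun h' => hC (by rw [← hi₁, ← hi₂, h'])
  have hball : ∀ R : Finset (Fin h), R.card ≤ t → R ≠ A₁ → R ≠ A₂ → ∃ i, i ≠ i₁ ∧ i ≠ i₂ ∧ u i = R := by
    intro R hR hR₁ hR₂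
    obtain ⟨i, hi⟩ := hhit R (Finset.mem_insert_of_mem (Finset.mem_insert_of_mem
      (Finset.mem_erase.2 ⟨hR₂, Finset.mem_erase.2 ⟨hR₁, Finset.mem_filter.2 ⟨Finset.mem_univ _, hR⟩⟩⟩)))
    refine ⟨i, ?_, ?_, hi⟩ <;> (rintro rfl; first | (rw [hi₁] at hi) | (rw [hi₂] at hi)) <;> (rw [← hi] at hR; omega)
  -- the ball enumeration `b = u[i₁ ↦ A₁][i₂ ↦ A₂]`
  let b : Fin r → Finset (Fin h) := Function.update (Function.update u i₁ A₁) i₂ A₂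
  have hb₁ : b i₁ = A₁ := by simp only [b, Function.update_of_ne hne, Function.update_self]
  have hb₂ : b i₂ = A₂ := by simp only [b, Function.update_self]
  have hb : ∀ i, i ≠ i₁ → i ≠ i₂ → b i = u i := fun i h1 h2 => by
    simp only [b, Function.update_of_ne h2, Function.update_of_ne h1]
  have hub : Function.update (Function.update b i₁ C₁) i₂ C₂ = u := by
    funext i
    by_cases h2 : i = i₂
    · subst h2; rw [Function.update_self, hi₂]
    · rw [Function.update_of_ne h2]
      by_cases h1 : i = i₁
      · subst h1; rw [Function.update_self, hi₁]
      · rw [Function.update_of_ne h1, hb i h1 h2]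
  have hbval : ∀ i, i ≠ i₁ → i ≠ i₂ → (b i).card ≤ t ∧ b i ≠ A₁ ∧ b i ≠ A₂ := by
    intro i h1 h2
    rw [hb i h1 h2]
    rcases hU i with h' | h' | h'
    · exact h'
    · exact absurd (hi₁ ▸ h') (fun hh => h1 (hu hh))
    · exact absurd (hi₂ ▸ h') (fun hh => h2 (hu hh))
  have hAu : ∀ i, u i ≠ A₁ ∧ u i ≠ A₂ := by
    intro i
    rcases hU i with ⟨-, hne₁, hne₂⟩ | h' | h'
    · exact ⟨hne₁, hne₂⟩
    · rw [h']; constructor <;> (intro h''; rw [h''] at hC₁; omega)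
    · rw [h']; constructor <;> (intro h''; rw [h''] at hC₂; omega)
  have hbinj : Function.Injective b := by
    refine update_injective _ (update_injective u hu i₁ A₁ fun i => (hAu i).1) i₂ A₂ fun i' => ?_
    by_cases h' : i' = i₁
    · rw [h', Function.update_self]; exact hA
    · rw [Function.update_of_ne h']; exact (hAu i').2
  have hC₁b : ∀ i, b i ≠ C₁ := by
    intro i h'
    by_cases h1 : i = i₁
    · rw [h1, hb₁] at h'; rw [h'] at hA₁; omega
    by_cases h2 : i = i₂
    · rw [h2, hb₂] at h'; rw [h'] at hA₂; omega
    · rw [hb i h1 h2, ← hi₁] at h'; exact h1 (hu h')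
  have hC₂b : ∀ i, b i ≠ C₂ := by
    intro i h'
    by_cases h1 : i = i₁
    · rw [h1, hb₁] at h'; rw [h'] at hA₁; omega
    by_cases h2 : i = i₂
    · rw [h2, hb₂] at h'; rw [h'] at hA₂; omega
    · rw [hb i h1 h2, ← hi₂] at h'; exact h2 (hu h')
  -- the two first-shell certificates
  have hF1 : (mat (tab2 N₁ N₂ ![1, 0]) (Function.update b i₁ C₁) cols).det ≠ 0 := by
    rw [hT10]
    refine swapTable'_det_ne_zero hk₁ A₁ C₁ e₁ m1 m2 m3 m4 _ cols (update_injective b hbinj i₁ C₁ hC₁b) ?_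
      (by rw [hkj₁]; exact hcols)
    intro i
    by_cases hi : i = i₁
    · right; rw [hi, Function.update_self]
    · left
      rw [Function.update_of_ne hi]
      by_cases h2 : i = i₂
      · rw [h2, hb₂]; exact ⟨by omega, Ne.symm hA⟩
      · have := hbval i hi h2; exact ⟨by rw [hkj₁]; exact this.1, this.2.1⟩
  have hF2 : (mat (tab2 N₁ N₂ ![0, 1]) (Function.update b i₂ C₂) cols).det ≠ 0 := by
    rw [hT01]
    refine swapTable'_det_ne_zero hk₂ A₂ C₂ e₂ n1 n2 n3 n4 _ cols (update_injective b hbinj i₂ C₂ hC₂b) ?_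
      (by rw [hkj₂]; exact hcols)
    intro i
    by_cases hi : i = i₂
    · right; rw [hi, Function.update_self]
    · left
      rw [Function.update_of_ne hi]
      by_cases h1 : i = i₁
      · rw [h1, hb₁]; exact ⟨by omega, hA⟩
      · have := hbval i h1 hi; exact ⟨by rw [hkj₂]; exact this.1, this.2.2⟩
  -- the rows of the two cross minors in key form
  have key₁ : ∀ S : Finset (Fin h), S.card ≤ t → S ≠ A₁ → ∃ i, i ≠ i₁ ∧ Function.update b i₁ C₂ i = S := by
    intro S hS hS₁
    by_cases hS₂ : S = A₂
    · exact ⟨i₂, hne.symm, by rw [Function.update_of_ne hne.symm, hb₂, hS₂]⟩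
    · obtain ⟨i, hi1, hi2, hi⟩ := hball S hS hS₁ hS₂
      exact ⟨i, hi1, by rw [Function.update_of_ne hi1, hb i hi1 hi2, hi]⟩
  have key₂ : ∀ S : Finset (Fin h), S.card ≤ t → S ≠ A₂ → ∃ i, i ≠ i₂ ∧ Function.update b i₂ C₁ i = S := by
    intro S hS hS₂
    by_cases hS₁ : S = A₁
    · exact ⟨i₁, hne, by rw [Function.update_of_ne hne, hb₁, hS₁]⟩
    · obtain ⟨i, hi1, hi2, hi⟩ := hball S hS hS₁ hS₂
      exact ⟨i, hi2, by rw [Function.update_of_ne hi2, hb i hi1 hi2, hi]⟩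
  -- ★ the composition
  have hZ' : (∀ ε, (mat (tab2 N₁ N₂ ε) (Function.update b i₁ C₂) cols).det = 0) ∨
      (∀ ε, (mat (tab2 N₁ N₂ ε) (Function.update b i₂ C₁) cols).det = 0) := by
    rcases hZ with hZ | hZ
    · exact Or.inl (hZ _ i₁ (Function.update_self _ _ _) key₁ hcolcard)
    · exact Or.inr (hZ _ i₂ (Function.update_self _ _ _) key₂ hcolcard)
  obtain ⟨tx, htx⟩ := exists_table_of_cross_zero N₁ N₂ b cols hne C₁ C₂ hF1 hF2 hZ'
  exact ⟨tx, by rw [hub] at htx; exact htx⟩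

end SecondShell

end

end Summit.ValiantsHypothesis.ValiantsHypothesis.Theorems.BarrierLever.HiddenStates
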